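import Summits.QuantumFields.YangMills.Theorems.LuscherReductionTwistedTraceScalingBOAssemblyBricks
import HarnessLib

/-!
# ★★★ THE BORN–OPPENHEIMER ASSEMBLY: `BOBricks L χ δ → SoftTubeBOPackageOn L χ {orbitDist < δ}`
# (lane A of S-BASE, crux `TwistedTraceScaling` stmt-QuantumFields-20203, C4 INNER; design note `pub/ym-fleet/ym-luscher-20007-p1/COARSE-DESIGN.md` §24.4 (G))

The Feshbach package in the support-separated tube currency (`…SoftTubeOn`, p644888) follows from the typed brick list `BOBricks` (`…BOAssemblyBricks`): the split is
`u = boProj w Ω 𝒰 f` (`…BOProjection`: MASS is EXACT Pythagoras), STIFF and OFFDIAG are the bricks (B-ST)/(B-OD) verbatim (with `tubeForm_add`), SLOW is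
`slow_clause_of_bricks` (colour average = cdisprove R32's repair, kernel brick (B-T), one-site no-intruder `innerNoIntruderOneOrbitAt_one` at `B = L³β`), FLOOR is
`floor_clause_of_bricks` (localized one-site near-maximiser `exists_localized_near_top`, kernel brick, tube floor glue, eight copies); WLOG `ε ≤ 1`, then `arith_slow` /
`arith_floor` with `y = ελ_b`, `κ ≤ y/48`.  With `innerNoIntruderOneOrbitAt_pow_of_bigRecordWeight_packageOn`: C4-CORE ⟸ `BOBricks L (recordWeightRho (3β^{-s}) (Mβ^{-s}) β^{-t}) β^{-s}`.
HONEST FRAMING: the assembly is PROVED; the analytic bricks (B-T) = (F), (B-ST), (B-OD) (and the structural data for the record weight) are OPEN; C4-CORE OPEN; this is a stub of a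
child of the CONDITIONAL reduction route R2b1; not infinite volume, not a gap, not Clay.
-/

set_option autoImplicit false

noncomputable section

open MeasureTheory Filter Topology Real
open scoped BigOperators
open Literature.MathematicalPhysics.QuantumFieldTheory
open Literature.MathematicalPhysics.QuantumLattice

namespace Summit.QuantumFields.YangMills.Theorems.FemtoTransferGap.TwoLattice.ConstTube

open Summit.QuantumFields.YangMills.Theorems.FemtoTransferGap
open Summit.QuantumFields.YangMills.Theorems.FemtoTransferGap.TwoLattice.Avg
open Summit.QuantumFields.YangMills.Theorems.FemtoTransferGap.TwoLattice.Stiff (LinkSpace)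

variable {L : ℕ} [NeZero L]

/-! ## §1 The remainder `v = f − Pf`: support and fibrewise orthogonality -/

/-- The remainder of a test function supported in `supp χ` with slow shadow in `𝒰` is supported in `supp χ` and fibrewise `w`-orthogonal to `Ω` over EVERY slow point. [folklore] -/
theorem remainder_props {χ w : GaugeConfig 3 L SU2 → ℝ} (hw : Measurable w) {Cw : ℝ} (hCw : ∀ U, |w U| ≤ Cw) {Ω : LinkSpace L → ℝ} (hΩ : Measurable Ω) {CΩ : ℝ}
    (hCΩ : ∀ x, |Ω x| ≤ CΩ) {𝒰 : Set (GaugeConfig 3 1 SU2)} (h𝒰 : MeasurableSet 𝒰) {Z₀ : ℝ} (hZ₀ : 0 < Z₀) (hZ : ∀ u ∈ 𝒰, Z₀ ≤ fibreMass L w Ω u)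
    (hbo : ∀ (φ : GaugeConfig 3 1 SU2 → ℝ) (U : GaugeConfig 3 L SU2), (∀ u, φ u ≠ 0 → u ∈ 𝒰) → boFun L φ Ω U ≠ 0 → χ U ≠ 0)
    {f : GaugeConfig 3 L SU2 → ℝ} (hf : Measurable f) {Cf : ℝ} (hCf : ∀ U, |f U| ≤ Cf) (hfs : ∀ U, f U ≠ 0 → χ U ≠ 0) (hfsh : ∀ U, f U ≠ 0 → slowMean L U ∈ 𝒰) :
    (∀ U, f U - boProj L w Ω 𝒰 f U ≠ 0 → χ U ≠ 0) ∧ ∀ u, fibreInner L w Ω (fun U => f U - boProj L w Ω 𝒰 f U) u = 0 := by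
  have hcs : ∀ u, boCoeff L w Ω 𝒰 f u ≠ 0 → u ∈ 𝒰 := fun u hu => by
    by_contra hnu; exact hu (show boCoeff L w Ω 𝒰 f u = 0 by unfold boCoeff; rw [Set.indicator_of_notMem hnu])
  refine ⟨fun U hU => ?_, fun u => ?_⟩
  · by_cases hfU : f U = 0
    · rw [hfU, zero_sub, neg_ne_zero] at hU
      exact hbo _ U hcs hU
    · exact hfs U hfU
  · by_cases hu : u ∈ 𝒰
    · exact fibreInner_sub_boProj hw hCw hΩ hCΩ h𝒰 hZ₀ hZ hf hCf hu
    · refine fibreInner_eq_zero_of_vanish fun v hv => ?_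
      have h1 : f (orthoTube L u v) = 0 := by
        by_contra h; exact hu (by rw [← slowMean_orthoTube L u hv]; exact hfsh _ h)
      have h2 : boProj L w Ω 𝒰 f (orthoTube L u v) = 0 := by
        unfold boProj; rw [boFun_orthoTube L _ Ω u hv]; unfold boCoeff; rw [Set.indicator_of_notMem hu, zero_mul]
      rw [h1, h2, sub_zero]

/-! ## §2 ★★★ The assembly -/

set_option maxHeartbeats 400000 in
/-- ★★★ **THE BORN–OPPENHEIMER PACKAGE FROM ITS BRICKS**: `BOBricks L χ δ → SoftTubeBOPackageOn L χ (fun β ↦ {U | orbitDist U < δ β})`.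
[cite: Luscher1983, §3] [cite: SjostrandZworski2007, §2] -/
theorem softTubeBOPackageOn_of_bricks {χ : ℝ → GaugeConfig 3 L SU2 → ℝ} {δ : ℝ → ℝ} (K : BOBricks L χ δ) :
    SoftTubeBOPackageOn L χ (fun β => {U | orbitDist U < δ β}) := by
  intro k ε hε
  -- WLOG `ε ≤ 1`
  set ε₁ : ℝ := min ε 1 with hε₁def
  have hε₁ : 0 < ε₁ := lt_min hε one_pos
  have hε₁1 : ε₁ ≤ 1 := min_le_right _ _
  have hε₁ε : ε₁ ≤ ε := min_le_left _ _
  obtain ⟨hθ0, hθ1⟩ := K.hθ₀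
  refine ⟨K.θ₀, hθ0, hθ1, ?_⟩
  have hL1 : (1 : ℝ) ≤ (L : ℝ) ^ 3 := one_le_pow₀ (by exact_mod_cast NeZero.one_le)
  have hL3 : (0 : ℝ) < (L : ℝ) ^ 3 := by positivity
  -- crux ONE at `B = L³β`
  obtain ⟨C1, B0, hONE⟩ := oneSiteLevels_proof k
  set τ : ℝ := 1 / (2 * (|levelGap k| + |C1| + 2)) with hτ
  have hτ0 : 0 < τ := by rw [hτ]; positivity
  -- the one-site no-intruder at radius `δ₁'(B) = δ₁(B/L³)`
  obtain ⟨b1, hb1⟩ := Filter.eventually_atTop.mp K.hδ₁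
  have hδ₁' : ∃ β1 : ℝ, ∀ B : ℝ, β1 ≤ B → (fun B => K.δ₁ (B / (L : ℝ) ^ 3)) B ≤ 1 / 2 :=
    ⟨b1 * (L : ℝ) ^ 3, fun B hB => hb1 _ (by show b1 ≤ B / (L : ℝ) ^ 3; rw [le_div_iff₀ hL3]; exact hB)⟩
  obtain ⟨βOS, hOS⟩ := innerNoIntruderOneOrbitAt_one hδ₁' k (ε₁ / 8) (by positivity)
  -- the localized near-maximiser
  obtain ⟨βNT, hNT⟩ := exists_localized_near_top (ε₁ / 16) (by positivity)
  -- the eight copies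
  obtain ⟨βc, hcross⟩ := crossBound_eventually_small (L := L) (m := K.m) K.hm0 (ε := ε₁ / 16) (by positivity)
  -- collect everything eventually in `β`
  have hev : ∀ᶠ β : ℝ in atTop, ∃ σ b : ℝ, 0 < σ ∧ 0 ≤ b ∧ b ^ 2 ≤ ε * K.θ₀ * bareLambda ((L : ℝ) ^ 3 * β) / 16 ∧
      Real.exp (-(ε / 4 * bareLambda ((L : ℝ) ^ 3 * β))) * (σ * levelValue su2Rep 1 ((L : ℝ) ^ 3 * β) 0) ≤ levelValue su2Rep L β 0 ∧
      ∀ f : Fin (k + 1) → (GaugeConfig 3 L SU2 → ℝ),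
        (∀ i, Measurable (f i)) → (∀ i, ∃ C : ℝ, ∀ U, |f i U| ≤ C) → (∀ i U, f i U ≠ 0 → χ β U ≠ 0) → (∀ i U, f i U ≠ 0 → U ∈ {U : GaugeConfig 3 L SU2 | orbitDist U < δ β}) →
        (∀ a : Fin (k + 1) → ℝ, a ≠ 0 → 0 < tubeNormSq (softWeight (χ β)) (fun U => ∑ i, a i * f i U)) →
          ∃ u v : Fin (k + 1) → (GaugeConfig 3 L SU2 → ℝ),
            (∀ a : Fin (k + 1) → ℝ,
              0 ≤ tubeNormSq (softWeight (χ β)) (fun U => ∑ i, a i * u i U) ∧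
              0 ≤ tubeNormSq (softWeight (χ β)) (fun U => ∑ i, a i * v i U) ∧
              tubeNormSq (softWeight (χ β)) (fun U => ∑ i, a i * u i U) + tubeNormSq (softWeight (χ β)) (fun U => ∑ i, a i * v i U) ≤
                tubeNormSq (softWeight (χ β)) (fun U => ∑ i, a i * f i U) ∧
              tubeForm β (fun U => ∑ i, a i * v i U) ≤
                (1 - K.θ₀) * (σ * levelValue su2Rep 1 ((L : ℝ) ^ 3 * β) 0) * tubeNormSq (softWeight (χ β)) (fun U => ∑ i, a i * v i U) ∧
              tubeForm β (fun U => ∑ i, a i * f i U) ≤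
                tubeForm β (fun U => ∑ i, a i * u i U) +
                  2 * (b * (σ * levelValue su2Rep 1 ((L : ℝ) ^ 3 * β) 0)) *
                    Real.sqrt (tubeNormSq (softWeight (χ β)) (fun U => ∑ i, a i * u i U)) *
                    Real.sqrt (tubeNormSq (softWeight (χ β)) (fun U => ∑ i, a i * v i U)) +
                  tubeForm β (fun U => ∑ i, a i * v i U)) ∧
            ∃ a : Fin (k + 1) → ℝ, a ≠ 0 ∧
              tubeForm β (fun U => ∑ i, a i * u i U) ≤
                Real.exp (ε / 4 * bareLambda ((L : ℝ) ^ 3 * β)) * (σ * levelValue su2Rep 1 ((L : ℝ) ^ 3 * β) k) *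
                  tubeNormSq (softWeight (χ β)) (fun U => ∑ i, a i * u i U) := by
    filter_upwards [Filter.eventually_ge_atTop (max (max 1 B0) (max (max βOS βNT) (max βc (2 / τ ^ 3)))),
      K.hκ_small (ε₁ / 48) (by positivity), K.hb_small (ε₁ * K.θ₀ / 16) (by positivity), K.hcore, K.htube, K.hshadow, K.hbo, K.hδ₂, K.hN, K.hT, K.hST, K.hOD]
      with β hβ hκs hbs hcore htube hshadow hbo hδ₂ hN hT hST hOD
    -- numbers
    have hβ1 : 1 ≤ β := ((le_max_left _ _).trans (le_max_left _ _)).trans hβ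
    have hβ0 : 0 < β := by linarith only [hβ1]
    have hβB0 : B0 ≤ β := ((le_max_right _ _).trans (le_max_left _ _)).trans hβ
    have hβOS : βOS ≤ β := (((le_max_left _ _).trans (le_max_left _ _)).trans (le_max_right _ _)).trans hβ
    have hβNT : βNT ≤ β := (((le_max_right _ _).trans (le_max_left _ _)).trans (le_max_right _ _)).trans hβ
    have hβc : βc ≤ β := (((le_max_left _ _).trans (le_max_right _ _)).trans (le_max_right _ _)).trans hβ
    have hβτ : 2 / τ ^ 3 ≤ β := (((le_max_right _ _).trans (le_max_right _ _)).trans (le_max_right _ _)).trans hβ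
    set B : ℝ := (L : ℝ) ^ 3 * β with hBdef
    have hBβ : β ≤ B := by rw [hBdef]; nlinarith only [hL1, hβ0]
    have hB0 : 0 < B := lt_of_lt_of_le hβ0 hBβ
    set lam : ℝ := bareLambda B with hlamdef
    have hlam0 : 0 < lam := bareLambda_pos' hB0
    have hlamτ : lam ≤ τ := bareLambda_cube_le (L := L) hτ0 hβτ
    have hτle : τ ≤ 1 / (2 * (|levelGap k| + |C1| + 2)) := le_of_eq hτ
    obtain ⟨-, -, hy⟩ := smallness_of_le hlam0.le (hlamτ.trans hτle)
    have hlam1 : lam ≤ 1 := by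
      have h22 : τ ≤ 1 / (2 * 2) := by
        rw [hτ]; apply div_le_div_of_nonneg_left (by norm_num) (by norm_num)
        nlinarith only [abs_nonneg (levelGap k), abs_nonneg C1]
      linarith only [hlamτ, h22]
    obtain ⟨hμ0, -, hμk⟩ := hONE B (hβB0.trans hBβ)
    set μ0 : ℝ := levelValue su2Rep 1 B 0 with hμ0def
    set μk : ℝ := levelValue su2Rep 1 B k with hμkdef
    have hμk' : Real.exp (-(levelGap k * lam + |C1| * lam ^ 2)) * μ0 ≤ μk := by
      refine le_trans (mul_le_mul_of_nonneg_right (Real.exp_le_exp.2 ?_) hμ0.le) hμk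
      have := mul_le_mul_of_nonneg_right (le_abs_self C1) (sq_nonneg lam)
      linarith only [this]
    have hμk2 : μ0 / 2 ≤ μk := half_le_of_exp_lower hy hμ0.le hμk'
    have hμkpos : 0 < μk := by linarith only [hμk2, hμ0]
    -- `y = ε₁ λ`, `κ ≤ y/48`
    set y : ℝ := ε₁ * lam with hydef
    have hy0 : 0 ≤ y := by positivity
    have hy1 : y ≤ 1 := by rw [hydef]; nlinarith only [hε₁1, hlam1, hlam0, hε₁]
    have hκ0 := K.hκ β
    have hκy : K.κ β ≤ y / 48 := by rw [hydef]; linarith only [hκs]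
    have hκ1 : K.κ β < 1 := by linarith only [hκy, hy1]
    have hκ1' : K.κ β ≤ 1 := hκ1.le
    set w : GaugeConfig 3 L SU2 → ℝ := softWeight (χ β) with hwdef
    obtain ⟨Cw, hCw⟩ := K.hwb β
    obtain ⟨hc0, hcχ⟩ := K.hc β
    -- fibre mass lower bound (for the projection)
    have hZ₀ : 0 < K.γ β * (1 - K.κ β) := mul_pos (K.hγ β) (by linarith)
    have hZ : ∀ u ∈ K.𝒰 β, K.γ β * (1 - K.κ β) ≤ fibreMass L w (K.Ω β) u := fun u hu => by
      have := (abs_le.mp (hN u hu)).1; linarith only [this]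
    refine ⟨K.σ β, K.b β, K.hσ β, K.hb β, ?_, ?_, ?_⟩
    · -- b² ≤ ε θ λ / 16
      have h' : ε₁ * K.θ₀ / 16 * lam ≤ ε * K.θ₀ * lam / 16 := by
        have := mul_le_mul_of_nonneg_right hε₁ε (mul_nonneg hθ0.le hlam0.le); linarith only [this]
      exact hbs.trans h'
    · -- FLOOR
      obtain ⟨φ₀, hφm, ⟨C₀, hC₀⟩, hφg, hφsupp, hφpos, hφtop⟩ := hNT B (hβNT.trans hBβ)
      have hφs : ∀ u, φ₀ u ≠ 0 → u ∈ K.𝒰 β := fun u hu => hcore u (hφsupp u hu)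
      have hTφ := hT φ₀ hφm ⟨C₀, hC₀⟩ hφg hφs
      have hTlow : K.σ β * K.γ β * (1 - K.κ β) * qform su2Rep B φ₀ φ₀ - K.κ β * K.σ β * K.γ β * μ0 * l2 φ₀ φ₀ ≤ tubeForm β (boFun L φ₀ (K.Ω β)) := by
        have := (abs_le.mp hTφ).1; linarith only [this]
      have hcB : 28 * crossBound L β K.m ≤ ε₁ / 16 * lam * levelValue su2Rep L β 0 :=
        (hcross β hβc).trans (mul_le_mul_of_nonneg_left (levelValue_zero_ge_uniform hβ1) (by positivity))
      have harith : Real.exp (-(ε₁ / 4 * lam)) * ((1 + ε₁ / 16 * lam / 4) * (1 + K.κ β)) ≤ (1 - K.κ β) * Real.exp (-(ε₁ / 16 * lam)) - K.κ β := by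
        have h := arith_floor hy0 hy1 hκ0 hκy
        have e1 : ε₁ / 4 * lam = y / 4 := by rw [hydef]; ring
        have e2 : ε₁ / 16 * lam / 4 = y / 64 := by rw [hydef]; ring
        have e3 : ε₁ / 16 * lam = y / 16 := by rw [hydef]; ring
        rw [e1, e2, e3]; exact h
      have hfl := floor_clause_of_bricks hβ0.le (K.hχm β) (K.hχ1 β) (K.hχ0 β) hc0 hcχ (K.hwm β) hCw (K.hΩm β) (K.hΩ1 β) K.hm hδ₂
        (fun φ U hφ hU => hbo φ U hφ hU) (K.hσ β).le (K.hγ β) hκ0 hκ1' hN hφm hC₀ hφs hφpos hφtop hTlow hcB (by positivity) hμ0.le harith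
      refine le_trans (mul_le_mul_of_nonneg_right (Real.exp_le_exp.mpr ?_) (mul_nonneg (K.hσ β).le hμ0.le)) hfl
      have := mul_le_mul_of_nonneg_right hε₁ε hlam0.le
      linarith only [this]
    · -- the split for an admissible family
      intro f hfm hfb hfs hfS hGram
      set u : Fin (k + 1) → GaugeConfig 3 L SU2 → ℝ := fun i => boProj L w (K.Ω β) (K.𝒰 β) (f i) with hudef
      set v : Fin (k + 1) → GaugeConfig 3 L SU2 → ℝ := fun i => fun U => f i U - u i U with hvdef
      choose Cf hCf using hfb
      -- combinations
      have hfam : ∀ a : Fin (k + 1) → ℝ, Measurable (fun U => ∑ i, a i * f i U) := fun a => Finset.measurable_sum _ fun i _ => (hfm i).const_mul _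
      have hfab : ∀ a : Fin (k + 1) → ℝ, ∀ U, |∑ i, a i * f i U| ≤ ∑ i, |a i| * Cf i := fun a U =>
        (Finset.abs_sum_le_sum_abs _ _).trans (Finset.sum_le_sum fun i _ => by rw [abs_mul]; exact mul_le_mul_of_nonneg_left (hCf i U) (abs_nonneg _))
      have hfas : ∀ (a : Fin (k + 1) → ℝ) U, (∑ i, a i * f i U) ≠ 0 → χ β U ≠ 0 := fun a U hU => by
        obtain ⟨i, hi⟩ := exists_ne_zero_of_combination_ne_zero hU; exact hfs i U hi
      have hfash : ∀ (a : Fin (k + 1) → ℝ) U, (∑ i, a i * f i U) ≠ 0 → slowMean L U ∈ K.𝒰 β := fun a U hU => by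
        obtain ⟨i, hi⟩ := exists_ne_zero_of_combination_ne_zero hU; exact hshadow U (hfs i U hi) (hfS i U hi)
      have hua : ∀ a : Fin (k + 1) → ℝ, (fun U => ∑ i, a i * u i U) = boProj L w (K.Ω β) (K.𝒰 β) (fun U => ∑ i, a i * f i U) := fun a => by
        funext U; exact (boProj_sum (K.hwm β) hCw (K.hΩm β) (K.hΩ1 β) (K.𝒰 β) a hfm (fun i => ⟨Cf i, hCf i⟩) U).symm
      have hva : ∀ a : Fin (k + 1) → ℝ, (fun U => ∑ i, a i * v i U) = fun U => (∑ i, a i * f i U) - boProj L w (K.Ω β) (K.𝒰 β) (fun U => ∑ i, a i * f i U) U := fun a => by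
        funext U
        rw [← congrFun (hua a) U]
        simp only [hvdef, mul_sub, Finset.sum_sub_distrib]
      -- the projection of `f_a`: measurable, bounded
      have hPm : ∀ a : Fin (k + 1) → ℝ, Measurable (boProj L w (K.Ω β) (K.𝒰 β) (fun U => ∑ i, a i * f i U)) := fun a =>
        measurable_boFun L (measurable_boCoeff (K.hwm β) (K.hΩm β) (K.h𝒰m β) (hfam a)) (K.hΩm β)
      have hPb : ∀ a : Fin (k + 1) → ℝ, ∀ U, |boProj L w (K.Ω β) (K.𝒰 β) (fun U => ∑ i, a i * f i U) U| ≤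
          (∑ i, |a i| * Cf i) * 1 * Cw * (orthoTransverse L).real Set.univ / (K.γ β * (1 - K.κ β)) * 1 := fun a =>
        abs_boFun_le L (abs_boCoeff_le hCw (K.hΩ1 β) hZ₀ hZ (hfab a)) (K.hΩ1 β)
      have hrem := fun a : Fin (k + 1) → ℝ => remainder_props (K.hwm β) hCw (K.hΩm β) (K.hΩ1 β) (K.h𝒰m β) hZ₀ hZ (fun φ U hφ hU => (hbo φ U hφ hU).1)
        (hfam a) (hfab a) (hfas a) (hfash a)
      have hvm : ∀ a : Fin (k + 1) → ℝ, Measurable (fun U => (∑ i, a i * f i U) - boProj L w (K.Ω β) (K.𝒰 β) (fun U => ∑ i, a i * f i U) U) := fun a =>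
        (hfam a).sub (hPm a)
      have hvb : ∀ a : Fin (k + 1) → ℝ, ∀ U, |(∑ i, a i * f i U) - boProj L w (K.Ω β) (K.𝒰 β) (fun U => ∑ i, a i * f i U) U| ≤
          (∑ i, |a i| * Cf i) + (∑ i, |a i| * Cf i) * 1 * Cw * (orthoTransverse L).real Set.univ / (K.γ β * (1 - K.κ β)) * 1 := fun a U =>
        (abs_sub _ _).trans (add_le_add (hfab a U) (hPb a U))
      refine ⟨u, v, fun a => ⟨?_, ?_, ?_, ?_, ?_⟩, ?_⟩
      · exact integral_nonneg fun U => mul_nonneg (sq_nonneg _) (K.hw0 β U)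
      · exact integral_nonneg fun U => mul_nonneg (sq_nonneg _) (K.hw0 β U)
      · -- MASS (exact)
        rw [hua a, hva a]
        exact le_of_eq (tubeNormSq_boProj_add (K.hwm β) hCw (K.hΩm β) (K.hΩ1 β) (K.h𝒰m β) hZ₀ hZ (hfam a) (hfab a))
      · -- STIFF
        rw [hva a]
        exact hST _ (hvm a) ⟨_, hvb a⟩ (hrem a).1 (hrem a).2
      · -- OFFDIAG
        have hum' : Measurable (fun U => ∑ i, a i * u i U) := by rw [hua a]; exact hPm a
        have hub' : ∀ U, |∑ i, a i * u i U| ≤ (∑ i, |a i| * Cf i) * 1 * Cw * (orthoTransverse L).real Set.univ / (K.γ β * (1 - K.κ β)) * 1 := fun U => by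
          have e := congrFun (hua a) U; rw [e]; exact hPb a U
        have hvm' : Measurable (fun U => ∑ i, a i * v i U) := by rw [hva a]; exact hvm a
        have hvb' : ∀ U, |∑ i, a i * v i U| ≤ (∑ i, |a i| * Cf i) + (∑ i, |a i| * Cf i) * 1 * Cw * (orthoTransverse L).real Set.univ / (K.γ β * (1 - K.κ β)) * 1 :=
          fun U => by have e := congrFun (hva a) U; rw [e]; exact hvb a U
        have hvs' : ∀ U, (∑ i, a i * v i U) ≠ 0 → χ β U ≠ 0 := fun U hU => by
          have e := congrFun (hva a) U; rw [e] at hU; exact (hrem a).1 U hU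
        have hvo' : ∀ u', fibreInner L w (K.Ω β) (fun U => ∑ i, a i * v i U) u' = 0 := fun u' => by rw [hva a]; exact (hrem a).2 u'
        have hsplit : (fun U => ∑ i, a i * f i U) = fun U => (∑ i, a i * u i U) + (∑ i, a i * v i U) := by
          funext U; rw [← Finset.sum_add_distrib]; exact Finset.sum_congr rfl fun i _ => by simp only [hvdef]; ring
        rw [hsplit, tubeForm_add β hum' hub' hvm' hvb']
        have hcs : ∀ u', boCoeff L w (K.Ω β) (K.𝒰 β) (fun U => ∑ i, a i * f i U) u' ≠ 0 → u' ∈ K.𝒰 β := fun u' hu => by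
          by_contra hnu; exact hu (show boCoeff L w (K.Ω β) (K.𝒰 β) _ u' = 0 by unfold boCoeff; rw [Set.indicator_of_notMem hnu])
        have e1 : boFun L (boCoeff L w (K.Ω β) (K.𝒰 β) (fun U => ∑ i, a i * f i U)) (K.Ω β) = fun U => ∑ i, a i * u i U := (hua a).symm
        obtain ⟨h1, h2⟩ := hOD (boCoeff L w (K.Ω β) (K.𝒰 β) (fun U => ∑ i, a i * f i U)) (fun U => ∑ i, a i * v i U)
          (measurable_boCoeff (K.hwm β) (K.hΩm β) (K.h𝒰m β) (hfam a)) ⟨_, abs_boCoeff_le hCw (K.hΩ1 β) hZ₀ hZ (hfab a)⟩ hcs hvm' ⟨_, hvb'⟩ hvs' hvo'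
        rw [e1] at h1 h2
        have h1' := (abs_le.mp h1).2
        have h2' := (abs_le.mp h2).2
        linarith only [h1', h2']
      · -- SLOW
        have hTup : ∀ φ : GaugeConfig 3 1 SU2 → ℝ, Measurable φ → (∃ C : ℝ, ∀ u, |φ u| ≤ C) →
            (∀ (g : Site 3 1 → SU2) (u : GaugeConfig 3 1 SU2), φ (gaugeTransform g u) = φ u) → (∀ u, φ u ≠ 0 → u ∈ K.𝒰 β) →
            tubeForm β (boFun L φ (K.Ω β)) ≤ K.σ β * K.γ β * (1 + K.κ β) * qform su2Rep ((L : ℝ) ^ 3 * β) φ φ + K.κ β * K.σ β * K.γ β * levelValue su2Rep 1 ((L : ℝ) ^ 3 * β) 0 * l2 φ φ :=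
          fun φ h1 h2 h3 h4 => by have := (abs_le.mp (hT φ h1 h2 h3 h4)).2; linarith only [this]
        have hOSB : ∀ G : Fin (k + 1) → (GaugeConfig 3 1 SU2 → ℝ), (∀ i, Measurable (G i)) → (∀ i, ∃ C : ℝ, ∀ U, |G i U| ≤ C) →
            (∀ i (g : Site 3 1 → SU2) (U : GaugeConfig 3 1 SU2), G i (gaugeTransform g U) = G i U) → (∀ i U, G i U ≠ 0 → orbitDist U < K.δ₁ β) →
            (∀ a : Fin (k + 1) → ℝ, a ≠ 0 → 0 < l2 (fun U => ∑ i, a i * G i U) (fun U => ∑ i, a i * G i U)) →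
              ∃ a : Fin (k + 1) → ℝ, a ≠ 0 ∧
                qform su2Rep ((L : ℝ) ^ 3 * β) (fun U => ∑ i, a i * G i U) (fun U => ∑ i, a i * G i U) * levelValue su2Rep 1 ((L : ℝ) ^ 3 * β) 0 ≤
                  Real.exp (ε₁ / 8 * bareLambda ((L : ℝ) ^ 3 * β)) * levelValue su2Rep 1 ((L : ℝ) ^ 3 * β) k * levelValue su2Rep 1 ((L : ℝ) ^ 3 * β) 0 *
                    l2 (fun U => ∑ i, a i * G i U) (fun U => ∑ i, a i * G i U) := by
          intro G h1 h2 h3 h4 h5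
          have hδ₁B : K.δ₁ (B / (L : ℝ) ^ 3) = K.δ₁ β := by rw [hBdef, mul_comm, mul_div_assoc, div_self hL3.ne', mul_one]
          have h := hOS B (hβOS.trans hBβ) G h1 h2 h3 (fun i U hU => by show orbitDist U < K.δ₁ (B / (L : ℝ) ^ 3); rw [hδ₁B]; exact h4 i U hU) h5
          have e1 : ((1 : ℕ) : ℝ) ^ 3 * B = B := by rw [Nat.cast_one, one_pow, one_mul]
          simp only [e1] at h
          exact h
        have harith : (1 + K.κ β) * Real.exp (ε₁ / 8 * lam) * μk + K.κ β * μ0 ≤ (1 - K.κ β) * Real.exp (ε₁ / 4 * lam) * μk := by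
          have h := arith_slow hy0 hy1 hκ0 hκy hμ0.le hμk2
          have e1 : ε₁ / 8 * lam = y / 8 := by rw [hydef]; ring
          have e2 : ε₁ / 4 * lam = y / 4 := by rw [hydef]; ring
          rw [e1, e2]; exact h
        obtain ⟨a, ha, hslow⟩ := slow_clause_of_bricks (K.hwm β) hCw (K.hw0 β) (K.hwinv β) (K.hΩm β) (K.hΩ1 β) (K.hΩinv β) (K.h𝒰m β) (K.h𝒰inv β)
          (K.h𝒰δ₁ β) (K.hσ β).le (K.hγ β) hκ0 hκ1 hN hTup hOSB hμ0 hμkpos.le harith hfm (fun i => ⟨Cf i, hCf i⟩)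
        refine ⟨a, ha, hslow.trans ?_⟩
        refine mul_le_mul_of_nonneg_right (mul_le_mul_of_nonneg_right (Real.exp_le_exp.mpr ?_) (mul_nonneg (K.hσ β).le hμkpos.le)) ?_
        · have := mul_le_mul_of_nonneg_right hε₁ε hlam0.le
          linarith only [this]
        · exact integral_nonneg fun U => mul_nonneg (sq_nonneg _) (K.hw0 β U)
  obtain ⟨β₀, hβ₀⟩ := Filter.eventually_atTop.mp hev
  exact ⟨β₀, fun β hβ => hβ₀ β hβ⟩

/-! ## §3 The record instance -/

/-- ★★★ **C4-CORE FROM THE BRICKS**: for the record weight `χ = recordWeightRho (3β^{-s}) (Mβ^{-s}) β^{-t}` (`M ≥ 6`), `BOBricks L χ β^{-s} → InnerNoIntruderOneOrbitAt L β^{-s}`.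
[cite: Luscher1983, §3] -/
theorem innerNoIntruderOneOrbitAt_pow_of_bricks (s t M : ℝ) (hM : 6 ≤ M)
    (K : BOBricks L (recordWeightRho L (fun β => 3 * powScale s β) (fun β => M * powScale s β) (powScale t)) (powScale s)) :
    InnerNoIntruderOneOrbitAt L (powScale s) :=
  innerNoIntruderOneOrbitAt_pow_of_bigRecordWeight_packageOn s t M hM (softTubeBOPackageOn_of_bricks K)

end Summit.QuantumFields.YangMills.Theorems.FemtoTransferGap.TwoLattice.ConstTube

end
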